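/-
Copyright (c) 2026 the pub-hodgecm-mathlib formalisation cell (harness21).  Prover seat hodgecm-mathlib-K2E3-p05 (g0), Track B «K2-LIT», engine E3, unit U4 «Keys»,
2026-09-03.  KERNEL module: THEOREMS ONLY (no definition, no named fact, no `sorry`, no instance, no notation).
-/
import Summits.HodgeConjecture.HodgeConjecture.Theorems.K2E3PSIwahoriBasis             -- ★ II-1 (this seat): `eq_smul_of_mem_fixedPoints_K0` & the frame letters; brings ★ PS-LEVELS, FILE C, ★ BruhatIwahoriThree
import Literature.NumberTheory.Automorphic.CompactOpenAveragingCompose                    -- ★ `Representation.avgProj`, `avgProj_eq`, `avgProj_mem_fixedPoints`, ★ `IsLeftTransversal`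
import Literature.NumberTheory.Automorphic.SmoothInductionBigCell                         -- ★ `Representation.SmoothInd.toFun_sum`
import HarnessLib

/-!
# K2 ∕ E3 «EllipticInputs», unit U4 «Keys» — Road II of MEMO `hK-KeysThmTwo`, stub II-2 (first half) «THE `K₀`-AVERAGE ON THE IWAHORI PLANE»:
# `e_{K₀}(x f₁ + y f_w) = [K₀:I]⁻¹ (x + ([K₀:I] − 1) y) · (f₁ + f_w)` for an unramified principal series of `U(Φ₃)(L⁺_v)`, `v` inert
# [Casselman1980 §3; BernsteinZelevinsky1976 §2.3 (the idempotent `e_K`); BruhatTits1972 (4.4.4) (`K₀ = I ⊔ IwI`)]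

Cell hodgecm-mathlib (D-0151), FLOOR 0, Track B «K2-LIT», engine E3, crux item H413 = stmt-HodgeConjecture-24833 (route `HCCMUnconditional`, no route verbs); target BY NAME
`…K2E3EllipticInputs.U4Keys.sig_K2E3KeysThmTwoContracting` (U4-f, U4Keys ED. 2), unramified first rung (Road II); abstract core ★ `K2E3ParahoricReducibilityCriterion` (p855172),
vectors ★ `K2E3PSIwahoriBasis` (II-1).  Author K2E3-p05 (g0).  `--supports stmt-HodgeConjecture-24833 --as helper`; THEOREMS ONLY; letters of ★ (G3)-EXPLICIT ∕ ★ PS-LEVELS.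

THE MATHEMATICS.  `χ` unramified, `V = i_G(χ)`, `(f₁, f_w)` the Iwahori pair of ★ II-1 (`I`-fixed, values `(1,0)`, `(0,1)` at `1, w̃`), `e_{K₀}` the averaging projector of ★
`CompactOpenAveraging` (`e_{K₀} v = |R|⁻¹ Σ_{r ∈ R} r·v` for a left transversal `R` of `K₀ ∕ I` when `I` fixes `v`, ★ `avgProj_eq`).  For `v = x f₁ + y f_w`:
`(e_{K₀} v)(1) = |R|⁻¹ Σ_r v(r)`, and by the DICHOTOMY `K₀ = I ⊔ (N ∩ K₀)·w̃·I` (★ `mem_inf_or_exists_eq_unipotentU_mul_weylLongU_mul` in the model, read through `eA`):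
`v(r) = v(1) = x` for the ONE `r ∈ R ∩ I`, and `v(n w̃ κ) = v(w̃) = y` for the `|R| − 1` others (the inducing line is trivial on `N ∩ K₀ ⊆ B ∩ K_v`, ★
`inducingLine_eq_one_of_mem_integralLevel`; right `I`-invariance).  Since `e_{K₀} v ∈ V^{K₀} = ℂ(f₁ + f_w)` (★ II-1 `eq_smul_of_mem_fixedPoints_K0`),
**`e_{K₀}(x f₁ + y f_w) = |R|⁻¹ (x + (|R| − 1) y)·(f₁ + f_w)`** — the `K₀`-form `(a₀ : b₀) = (1 : |R| − 1)`, `e₀ = f₁ + f_w` of ★ p855172's criterion, with `|R| = [K₀ : I]`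
(`= q³ + 1` at an inert place, ★ `UnitaryLatticeTreeLevelIndices`; left to the assembly II-4).  The `K₁`-form (the cell split of `I w̃′ I`) is the second half of II-2 (sequel).
* §1 `toFun_apply_of_mem_I`, `toFun_apply_of_not_mem_I` (values of an `I`-fixed vector on `K₀`: `v(r) = v(1)` on `I`, `= v(w̃)` on `K₀ ∖ I`) ·
  §2 `card_filter_mem_I_eq_one` (a left transversal of `K₀ ∕ I` meets `I` once) · §3 `avgProj_K0_eq` (the formula).
HONEST LABEL: HC_CM is proved only modulo the 7 printed citations (2 remaining named inputs: hLiu418 = stmt-HodgeConjecture-24832, h413 = stmt-HodgeConjecture-24833)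
until rung 0 closes; count-neutral (stub II-2a of a first rung of the row-#5 residue; no printed citation is discharged).

## References
* [Casselman1980] W. Casselman, Compositio Math. 40 (1980), §3.  * [BernsteinZelevinsky1976] Russian Math. Surveys 31:3 (1976), §2.3.
* [BruhatTits1972] F. Bruhat, J. Tits, Publ. Math. IHÉS 41 (1972), (4.4.4).  * [Rogawski1990] J. D. Rogawski, Ann. of Math. Stud. 123 (1990), §4.5 p. 45, §12.2 p. 173.
-/

set_option autoImplicit false
-- the mandated namespace has the single-problem summit's repeated segment (`HodgeConjecture.HodgeConjecture`)
set_option linter.dupNamespace false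

noncomputable section

open NumberField IsDedekindDomain MeasureTheory
open scoped Matrix MatrixGroups NNReal WithZero BigOperators
open Literature.NumberTheory.Automorphic Literature.NumberTheory.Automorphic.UnitaryGroup
open Literature.NumberTheory.Rogawski1990 Literature.NumberTheory.GaloisRepresentations

namespace Summit.HodgeConjecture.HodgeConjecture.Cruxes.H413.K2E3ParahoricAverageK0

open Summit.HodgeConjecture.HodgeConjecture.Cruxes.H413
open Summit.HodgeConjecture.HodgeConjecture.Cruxes.H413.F0P3cStCharTSStLevelsTransport
open Summit.HodgeConjecture.HodgeConjecture.Cruxes.H413.F0P3cStCharTSPSLevelsCells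
open Summit.HodgeConjecture.HodgeConjecture.Cruxes.H413.K2E3PSIwahoriBasis

variable (L : Type) [Field L] [NumberField L] [IsCMField L] (v : HeightOneSpectrum (𝓞 ↥(maximalRealSubfield L)))
  (w : PlacesOver L v) (hw : IsCMField.complexConj L • w.1 = w.1)
  (eA : Gqs L v ≃ₜ* ↥(unitaryGroupOfForm (galAdicCompletionMap (L := L) (IsCMField.complexConj L) hw) ((StdForm.antidiagonal 3).over (w.1.adicCompletion L))))
  (heA : ∀ g : Gqs L v,
    ((eA g : ↥(unitaryGroupOfForm (galAdicCompletionMap (L := L) (IsCMField.complexConj L) hw) ((StdForm.antidiagonal 3).over (w.1.adicCompletion L)))) : GL (Fin 3) (w.1.adicCompletion L)) =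
      ((localNonsplitEquiv (IsCMField.complexConj L) (qsForm L) (IsCMField.complexConj_ne_one L) w hw g :
        ↥(unitaryGroupOfForm (galAdicCompletionMap (L := L) (IsCMField.complexConj L) hw) (placeForm (qsForm L) w.1))) : GL (Fin 3) (w.1.adicCompletion L)))

/-! ## §1 Values of an `I`-fixed vector on `K₀ = I ⊔ (N ∩ K₀)·w̃·I` -/

set_option maxHeartbeats 3200000 in
set_option synthInstance.maxHeartbeats 400000 in
-- instance-path unification between `Gqs L v` and the literal carrier of ★ `cmPrincipalSeries` (class of ★ PS-LEVELS)
/-- **On `I` an `I`-fixed vector takes the value `f(1)`**: `f(r) = f(1·r) = (r·f)(1) = f(1)`. [cite: Casselman1980, §3] -/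
theorem toFun_apply_of_mem_I (I : Subgroup (Gqs L v))
    (χ : ↥(torusU (conjLocal L (IsCMField.complexConj L) v) (cmLocalForm L 3 v)) →* ℂˣ) :
    haveI := locallyCompactSpace_cmBorelU L 3 v
    ∀ (f : Representation.SmoothInd (cmBorelTriple L 3 v).P
        (Representation.twist (((Representation.trivial ℂ ↥(torusU (conjLocal L (IsCMField.complexConj L) v) (cmLocalForm L 3 v)) ℂ).twist χ).comp
          (cmBorelTriple L 3 v).proj) (rootDeltaChar (cmBorelTriple L 3 v).P))), f ∈ (cmPrincipalSeries L 3 v χ).fixedPoints I →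
      ∀ r : ↥(unitaryGroupOfForm (conjLocal L (IsCMField.complexConj L) v) (cmLocalForm L 3 v)), r ∈ I → f.toFun r = f.toFun 1 := by
  intro f hf r hr
  have e : (cmPrincipalSeries L 3 v χ r f).toFun 1 = f.toFun (1 * r) := Representation.toFun_smoothIndRep_apply r f 1
  rw [(Representation.mem_fixedPoints _ _ _).1 hf r hr, one_mul] at e
  exact e.symm

include heA in
set_option maxHeartbeats 6400000 in
set_option synthInstance.maxHeartbeats 400000 in
-- instance-path unification between `Gqs L v` and the literal carrier of ★ `cmPrincipalSeries` (class of ★ PS-LEVELS)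
/-- **On `K₀ ∖ I` an `I`-fixed vector of an UNRAMIFIED `i_G(χ)` takes the value `f(w̃)`**: by the dichotomy ★ `mem_inf_or_exists_eq_unipotentU_mul_weylLongU_mul` (model, read
through `eA`) such an `r` is `n·w̃·κ` with `n ∈ N ∩ K₀` (so `n ∈ B ∩ K_v`, where the inducing line is trivial, ★ `inducingLine_eq_one_of_mem_integralLevel`) and `κ ∈ I`;
hence `f(r) = σ_χ(n) f(w̃ κ) = f(w̃)`. [cite: BruhatTits1972, (4.4.4)] [cite: Casselman1980, §3] -/
theorem toFun_apply_of_not_mem_I {ϖ : w.1.adicCompletion L}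
    (hd : HermitianLattice.UnramifiedLocalConjDatum (galAdicCompletionMap (L := L) (IsCMField.complexConj L) hw) ϖ)
    (g₁ : GL (Fin 3) (w.1.adicCompletion L)) (hg₁ : (g₁ : Matrix (Fin 3) (Fin 3) (w.1.adicCompletion L)) = Matrix.diagonal ![(1 : w.1.adicCompletion L), 1, ϖ])
    (K0 K1 I : Subgroup (Gqs L v))
    (hK0 : K0 = ((glInt 3 (w.1.adicCompletion L)).subgroupOf
      (unitaryGroupOfForm (galAdicCompletionMap (L := L) (IsCMField.complexConj L) hw) ((StdForm.antidiagonal 3).over (w.1.adicCompletion L)))).comap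
        eA.toMulEquiv.toMonoidHom)
    (hK1 : K1 = (((glInt 3 (w.1.adicCompletion L)).map (MulAut.conj g₁).toMonoidHom).subgroupOf
      (unitaryGroupOfForm (galAdicCompletionMap (L := L) (IsCMField.complexConj L) hw) ((StdForm.antidiagonal 3).over (w.1.adicCompletion L)))).comap
        eA.toMulEquiv.toMonoidHom)
    (hI : I = K0 ⊓ K1)
    (χ : ↥(torusU (conjLocal L (IsCMField.complexConj L) v) (cmLocalForm L 3 v)) →* ℂˣ)
    (hU : ∀ t : ↥(torusU (conjLocal L (IsCMField.complexConj L) v) (cmLocalForm L 3 v)),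
      (t : ↥(unitaryGroupOfForm (conjLocal L (IsCMField.complexConj L) v) (cmLocalForm L 3 v))) ∈ cmLocalIntegralLevel L 3 (qsForm L) v → χ t = 1) :
    haveI := locallyCompactSpace_cmBorelU L 3 v
    ∀ (f : Representation.SmoothInd (cmBorelTriple L 3 v).P
        (Representation.twist (((Representation.trivial ℂ ↥(torusU (conjLocal L (IsCMField.complexConj L) v) (cmLocalForm L 3 v)) ℂ).twist χ).comp
          (cmBorelTriple L 3 v).proj) (rootDeltaChar (cmBorelTriple L 3 v).P))), f ∈ (cmPrincipalSeries L 3 v χ).fixedPoints I →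
      ∀ r : ↥(unitaryGroupOfForm (conjLocal L (IsCMField.complexConj L) v) (cmLocalForm L 3 v)), r ∈ K0 → r ∉ I →
        f.toFun r = f.toFun (eA.symm (weylLongU (galAdicCompletionMap (L := L) (IsCMField.complexConj L) hw) (rfl : (StdForm.antidiagonal 3).over (w.1.adicCompletion L) = _))) := by
  intro f hf r hrK0 hrI
  have hrK0' : eA r ∈ (glInt 3 (w.1.adicCompletion L)).subgroupOf
      (unitaryGroupOfForm (galAdicCompletionMap (L := L) (IsCMField.complexConj L) hw) ((StdForm.antidiagonal 3).over (w.1.adicCompletion L))) :=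
    (mem_comap_iff L v w hw eA _ r).1 (hK0 ▸ hrK0)
  rcases mem_inf_or_exists_eq_unipotentU_mul_weylLongU_mul (galAdicCompletionMap (L := L) (IsCMField.complexConj L) hw)
      (rfl : (StdForm.antidiagonal 3).over (w.1.adicCompletion L) = _) hd.σσ hd.vσ hd.vϖ g₁ hg₁ hrK0' with hI' | ⟨n, hnN, hnK0, κ, hκ, hrnk⟩
  · -- `eA r ∈ I_model`, i.e. `r ∈ I`: excluded
    exact absurd (hI.symm ▸ Subgroup.mem_inf.2 ⟨hK0 ▸ (mem_comap_iff L v w hw eA _ r).2 (Subgroup.mem_inf.1 hI').1,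
      hK1 ▸ (mem_comap_iff L v w hw eA _ r).2 (Subgroup.mem_inf.1 hI').2⟩) hrI
  · -- `r = ñ · w̃ · κ̃` with `ñ = eA⁻¹ n ∈ B ∩ K₀`, `κ̃ = eA⁻¹ κ ∈ I`
    have hnB : (eA.symm n : ↥(unitaryGroupOfForm (conjLocal L (IsCMField.complexConj L) v) (cmLocalForm L 3 v))) ∈ (cmBorelTriple L 3 v).P := eA_symm_mem_borel L v w hw eA heA (unipotentU_le_borelU _ _ hnN)
    have hnK : (eA.symm n : ↥(unitaryGroupOfForm (conjLocal L (IsCMField.complexConj L) v) (cmLocalForm L 3 v))) ∈ K0 := hK0 ▸ (symm_mem_comap_iff L v w hw eA _ n).2 hnK0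
    have hκI : (eA.symm κ : ↥(unitaryGroupOfForm (conjLocal L (IsCMField.complexConj L) v) (cmLocalForm L 3 v))) ∈ I := by
      rw [hI]
      exact Subgroup.mem_inf.2 ⟨hK0 ▸ (symm_mem_comap_iff L v w hw eA _ κ).2 (Subgroup.mem_inf.1 hκ).1,
        hK1 ▸ (symm_mem_comap_iff L v w hw eA _ κ).2 (Subgroup.mem_inf.1 hκ).2⟩
    have hr : r = ((⟨eA.symm n, hnB⟩ : ↥(cmBorelTriple L 3 v).P) : ↥(unitaryGroupOfForm (conjLocal L (IsCMField.complexConj L) v) (cmLocalForm L 3 v))) * ((![(1 : ↥(unitaryGroupOfForm (conjLocal L (IsCMField.complexConj L) v) (cmLocalForm L 3 v))), eA.symm (weylLongU (galAdicCompletionMap (L := L) (IsCMField.complexConj L) hw) (rfl : (StdForm.antidiagonal 3).over (w.1.adicCompletion L) = _))] 1) * (show ↥(unitaryGroupOfForm (conjLocal L (IsCMField.complexConj L) v) (cmLocalForm L 3 v)) from eA.symm κ)) := by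
      apply eA.injective
      change eA r = eA (eA.symm n * (eA.symm (weylLongU (galAdicCompletionMap (L := L) (IsCMField.complexConj L) hw)
        (rfl : (StdForm.antidiagonal 3).over (w.1.adicCompletion L) = _)) * eA.symm κ))
      rw [map_mul, map_mul, ContinuousMulEquiv.apply_symm_apply, ContinuousMulEquiv.apply_symm_apply, ContinuousMulEquiv.apply_symm_apply,
        ← mul_assoc]
      exact hrnk
    -- the inducing line is trivial at `ñ ∈ B ∩ K_v`
    have hline := inducingLine_eq_one_of_mem_integralLevel L v χ hU ⟨_, hnB⟩ ((mem_K0_iff_mem_integralLevel L v w hw eA heA K0 hK0 _).1 hnK)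
    -- `f(w̃) = (κ̃·f)(w̃) = f(w̃ κ̃)` and `f(ñ (w̃ κ̃)) = σ(ñ) f(w̃ κ̃) = f(w̃ κ̃)`
    have e2 : (cmPrincipalSeries L 3 v χ (show ↥(unitaryGroupOfForm (conjLocal L (IsCMField.complexConj L) v) (cmLocalForm L 3 v)) from eA.symm κ) f).toFun (![(1 : ↥(unitaryGroupOfForm (conjLocal L (IsCMField.complexConj L) v) (cmLocalForm L 3 v))), eA.symm (weylLongU (galAdicCompletionMap (L := L) (IsCMField.complexConj L) hw) (rfl : (StdForm.antidiagonal 3).over (w.1.adicCompletion L) = _))] 1) = f.toFun ((![(1 : ↥(unitaryGroupOfForm (conjLocal L (IsCMField.complexConj L) v) (cmLocalForm L 3 v))), eA.symm (weylLongU (galAdicCompletionMap (L := L) (IsCMField.complexConj L) hw) (rfl : (StdForm.antidiagonal 3).over (w.1.adicCompletion L) = _))] 1) * (show ↥(unitaryGroupOfForm (conjLocal L (IsCMField.complexConj L) v) (cmLocalForm L 3 v)) from eA.symm κ)) :=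
      Representation.toFun_smoothIndRep_apply (show ↥(unitaryGroupOfForm (conjLocal L (IsCMField.complexConj L) v) (cmLocalForm L 3 v)) from eA.symm κ) f _
    rw [(Representation.mem_fixedPoints _ _ _).1 hf _ hκI] at e2
    rw [hr, Representation.SmoothInd.toFun_subgroup_mul f ⟨_, hnB⟩, hline, Module.End.one_apply, ← e2]
    simp

/-! ## §2 A left transversal of `K₀ ∕ I` meets `I` exactly once -/

open Classical in
/-- **`#(R ∩ I) = 1`** for a left transversal `R` of `K₀` modulo `K₀ ⊓ I` (the representative of the identity coset). [folklore] -/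
theorem card_filter_mem_I_eq_one (K0 I : Subgroup (Gqs L v)) (R : Finset (Gqs L v)) (hR : IsLeftTransversal K0 (K0 ⊓ I) R) :
    (R.filter fun r => r ∈ I).card = 1 := by
  obtain ⟨r₀, ⟨hr₀R, hr₀⟩, huniq⟩ := hR.existsUnique 1 K0.one_mem
  rw [mul_one] at hr₀
  refine Finset.card_eq_one.2 ⟨r₀, Finset.ext fun r => ?_⟩
  rw [Finset.mem_filter, Finset.mem_singleton]
  constructor
  · rintro ⟨hrR, hrI⟩
    exact huniq r ⟨hrR, by rw [mul_one]; exact Subgroup.mem_inf.2 ⟨K0.inv_mem (hR.mem_of_mem r hrR), I.inv_mem hrI⟩⟩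
  · rintro rfl
    exact ⟨hr₀R, by simpa using I.inv_mem (Subgroup.mem_inf.1 hr₀).2⟩

/-! ## §3 The `K₀`-average on the Iwahori plane -/

include heA in
set_option maxHeartbeats 12000000 in
set_option synthInstance.maxHeartbeats 400000 in
-- statement∕proof-heavy: the `SmoothInd` carrier of `cmPrincipalSeries`, averaging and II-1 (class of ★ II-1 §3)
/-- **`e_{K₀}(x f₁ + y f_w) = |R|⁻¹ (x + (|R| − 1) y) · (f₁ + f_w)`** for the Iwahori pair `(f₁, f_w)` of an unramified `i_G(χ)` and any left transversal `R` of
`K₀ ∕ I` (`|R| = [K₀ : I]`): ★ `avgProj_eq` + §1 (values on `I` and on `K₀ ∖ I`) + §2 + ★ II-1 `eq_smul_of_mem_fixedPoints_K0` (`e_{K₀} v ∈ V^{K₀} = ℂ(f₁ + f_w)`).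
This is the `K₀`-datum `(a₀ : b₀) = (1 : [K₀:I] − 1)`, `e₀ = f₁ + f_w` of ★ `criterion_of_iwahoriLine`. [cite: Casselman1980, §3] [cite: BernsteinZelevinsky1976, §2.3] -/
theorem avgProj_K0_eq {ϖ : w.1.adicCompletion L}
    (hd : HermitianLattice.UnramifiedLocalConjDatum (galAdicCompletionMap (L := L) (IsCMField.complexConj L) hw) ϖ)
    (g₁ : GL (Fin 3) (w.1.adicCompletion L)) (hg₁ : (g₁ : Matrix (Fin 3) (Fin 3) (w.1.adicCompletion L)) = Matrix.diagonal ![(1 : w.1.adicCompletion L), 1, ϖ])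
    (K0 K1 I : Subgroup (Gqs L v))
    (hK0 : K0 = ((glInt 3 (w.1.adicCompletion L)).subgroupOf
      (unitaryGroupOfForm (galAdicCompletionMap (L := L) (IsCMField.complexConj L) hw) ((StdForm.antidiagonal 3).over (w.1.adicCompletion L)))).comap
        eA.toMulEquiv.toMonoidHom)
    (hK1 : K1 = (((glInt 3 (w.1.adicCompletion L)).map (MulAut.conj g₁).toMonoidHom).subgroupOf
      (unitaryGroupOfForm (galAdicCompletionMap (L := L) (IsCMField.complexConj L) hw) ((StdForm.antidiagonal 3).over (w.1.adicCompletion L)))).comap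
        eA.toMulEquiv.toMonoidHom)
    (hI : I = K0 ⊓ K1)
    (χ : ↥(torusU (conjLocal L (IsCMField.complexConj L) v) (cmLocalForm L 3 v)) →* ℂˣ)
    (hU : ∀ t : ↥(torusU (conjLocal L (IsCMField.complexConj L) v) (cmLocalForm L 3 v)),
      (t : ↥(unitaryGroupOfForm (conjLocal L (IsCMField.complexConj L) v) (cmLocalForm L 3 v))) ∈ cmLocalIntegralLevel L 3 (qsForm L) v → χ t = 1)
    (R : Finset (Gqs L v)) (hR : IsLeftTransversal K0 (K0 ⊓ I) R) :
    haveI := locallyCompactSpace_cmBorelU L 3 v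
    ∀ (f₁ f_w : Representation.SmoothInd (cmBorelTriple L 3 v).P
        (Representation.twist (((Representation.trivial ℂ ↥(torusU (conjLocal L (IsCMField.complexConj L) v) (cmLocalForm L 3 v)) ℂ).twist χ).comp
          (cmBorelTriple L 3 v).proj) (rootDeltaChar (cmBorelTriple L 3 v).P))),
      f₁ ∈ (cmPrincipalSeries L 3 v χ).fixedPoints I → f_w ∈ (cmPrincipalSeries L 3 v χ).fixedPoints I →
      f₁.toFun 1 = 1 →
      f₁.toFun (eA.symm (weylLongU (galAdicCompletionMap (L := L) (IsCMField.complexConj L) hw) (rfl : (StdForm.antidiagonal 3).over (w.1.adicCompletion L) = _))) = 0 →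
      f_w.toFun 1 = 0 →
      f_w.toFun (eA.symm (weylLongU (galAdicCompletionMap (L := L) (IsCMField.complexConj L) hw) (rfl : (StdForm.antidiagonal 3).over (w.1.adicCompletion L) = _))) = 1 →
      ∀ x y : ℂ, Representation.avgProj (G := Gqs L v) (cmPrincipalSeries L 3 v χ) K0 (x • f₁ + y • f_w) =
        ((R.card : ℂ)⁻¹ * (x + ((R.card : ℂ) - 1) * y)) • (f₁ + f_w) := by
  classical
  intro f₁ f_w hf₁ hf_w h11 h1w hw1 hww x y
  have hlev := isOpen_isCompact_levels L v w hw eA g₁ K0 K1 I hK0 hK1 hI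
  have hK0c : IsCompact (K0 : Set (Gqs L v)) := hlev.1.2
  have hIo : IsOpen (I : Set (Gqs L v)) := hlev.2.2.1
  -- `v = x f₁ + y f_w` is `I`-fixed, hence smooth, and `e_{K₀} v` is a finite average (★ `avgProj_eq`)
  have hv : x • f₁ + y • f_w ∈ (cmPrincipalSeries L 3 v χ).fixedPoints I := Submodule.add_mem _ (Submodule.smul_mem _ _ hf₁) (Submodule.smul_mem _ _ hf_w)
  have hTv : ∀ t ∈ I, (cmPrincipalSeries L 3 v χ) t (x • f₁ + y • f_w) = x • f₁ + y • f_w := fun t ht => (Representation.mem_fixedPoints _ _ _).1 hv t ht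
  have havg := Representation.avgProj_eq (G := Gqs L v) (ρ := cmPrincipalSeries L 3 v χ) hK0c hIo hTv hR
  have hsm : Representation.IsSmoothVector (G := Gqs L v) (cmPrincipalSeries L 3 v χ) (x • f₁ + y • f_w) :=
    F0P2pCmPrincipalSeriesInterface.isSmooth_cmPrincipalSeries L v χ _
  have hmem := Representation.avgProj_mem_fixedPoints (G := Gqs L v) (ρ := cmPrincipalSeries L 3 v χ) hK0c hsm
  -- `e_{K₀} v ∈ V^{K₀} = ℂ(f₁ + f_w)` (★ II-1)
  have hline := eq_smul_of_mem_fixedPoints_K0 L v w hw eA heA hd g₁ hg₁ K0 K1 I hK0 hK1 hI χ f₁ f_w _ hf₁ hf_w hmem h11 h1w hw1 hww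
  -- values: `v(1) = x`, `v(w̃) = y`; `(r·v)(1) = v(r) = x` on `I`, `= y` on `K₀ ∖ I`
  have hv1 : (x • f₁ + y • f_w).toFun 1 = x := by
    simp [Representation.SmoothInd.toFun_add, Representation.SmoothInd.toFun_smul, h11, hw1]
  have hvw : (x • f₁ + y • f_w).toFun (eA.symm (weylLongU (galAdicCompletionMap (L := L) (IsCMField.complexConj L) hw) (rfl : (StdForm.antidiagonal 3).over (w.1.adicCompletion L) = _))) = y := by
    simp [Representation.SmoothInd.toFun_add, Representation.SmoothInd.toFun_smul, h1w, hww]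
  have hval : ∀ r ∈ R, ((cmPrincipalSeries L 3 v χ) r (x • f₁ + y • f_w)).toFun 1 = if r ∈ I then x else y := by
    intro r hr
    have e : ((cmPrincipalSeries L 3 v χ) r (x • f₁ + y • f_w)).toFun 1 = (x • f₁ + y • f_w).toFun r := by
      have h := Representation.toFun_smoothIndRep_apply (show ↥(unitaryGroupOfForm (conjLocal L (IsCMField.complexConj L) v) (cmLocalForm L 3 v)) from r) (x • f₁ + y • f_w) 1
      rw [one_mul] at h
      exact h
    rw [e]
    by_cases hrI : r ∈ I
    · rw [if_pos hrI, toFun_apply_of_mem_I L v I χ _ hv r hrI, hv1]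
    · rw [if_neg hrI, toFun_apply_of_not_mem_I L v w hw eA heA hd g₁ hg₁ K0 K1 I hK0 hK1 hI χ (hU := hU) _ hv r (hR.mem_of_mem r hr) hrI, hvw]
  -- the scalar `(e_{K₀} v)(1) = |R|⁻¹ Σ_r v(r) = |R|⁻¹ (x + (|R| − 1) y)`
  have hone : (R.filter fun r => r ∈ I).card = 1 := card_filter_mem_I_eq_one L v K0 I R hR
  have hR1 : 1 ≤ R.card := hone ▸ Finset.card_filter_le R (fun r => r ∈ I)
  have hrest : (R.filter fun r => ¬ r ∈ I).card = R.card - 1 := by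
    have h := Finset.card_filter_add_card_filter_not (s := R) (fun r => r ∈ I)
    omega
  have hsum : ∑ r ∈ R, ((cmPrincipalSeries L 3 v χ) r (x • f₁ + y • f_w)).toFun 1 = x + ((R.card : ℂ) - 1) * y := by
    rw [Finset.sum_congr rfl hval, Finset.sum_ite, Finset.sum_const, Finset.sum_const, hone, hrest, one_smul, nsmul_eq_mul,
      Nat.cast_sub hR1, Nat.cast_one]
  have hscal : (Representation.avgProj (G := Gqs L v) (cmPrincipalSeries L 3 v χ) K0 (x • f₁ + y • f_w)).toFun 1 =
      (R.card : ℂ)⁻¹ * (x + ((R.card : ℂ) - 1) * y) := by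
    have h1 := congrArg (fun u => Representation.SmoothInd.toFun u 1) havg
    simp only [Representation.SmoothInd.toFun_smul, Pi.smul_apply, Representation.SmoothInd.toFun_sum, smul_eq_mul] at h1
    -- the two spellings of the sum (`G_v` read as `Gqs L v` ∕ as the matrix carrier) agree term by term, definitionally
    refine h1.trans (Eq.trans ?_ (congrArg (fun z : ℂ => (R.card : ℂ)⁻¹ * z) hsum))
    exact congrArg (fun z : ℂ => (R.card : ℂ)⁻¹ * z) (Finset.sum_congr rfl fun r _ => rfl)
  exact hline.trans (congrArg (fun t : ℂ => t • (f₁ + f_w)) hscal)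

end Summit.HodgeConjecture.HodgeConjecture.Cruxes.H413.K2E3ParahoricAverageK0

end
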